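import Mathlib
import HarnessLib
import Summits.HubbardSuperconductivity.HubbardSuperconductivity.Theorems.KLProgrammeKLRegimeEnginePairTransferRelResIdx

/-!
# Route `KLProgramme` — ENGINE child gen 8 (stmt-HubbardSuperconductivity-20437 `KLRegimeEngineV17F2`), skeleton v2 class #5 rev 3 (INDEX form, Export5), Ẽ-organisation:
# the `n = 0` BASE reduced to ONE scale-0 smearing estimate — `kltc_relResidue_le_of_sub`, **`pairTransferRelResIdx_zero_of_smearingBound`**
# (cell gate-hubbard-kl, seat hubbard-kl-k3c1-p1 g11, technique «composed-map remainder propagation»; wake AMENDMENT 9 = k3c2-p1 lineage owns the estimate)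

WHY.  In the Ẽ-organisation (`pairTransferStep5_of_private`, p594470; KLTC-INDEX-v8.1 §B′) the BASE is the private family at scale `0`:
«`‖Ẽ₀(s_{0,j} | s_{0,j′})(k,k′)‖ ≤ RB 0 j j′ Qm k k′` on the bare ball, `0 ≤ j′ ≤ j ≤ n_β+1`», `Ẽ₀ = (A°₀[s_j] − A°₀[s_j′]) + A°₀[s_j]·diag a·A°₀[s_j′]`,
`a = −(t₀[s_j] − t₀[s_j′])`.  The second summand is `≤ m²·Σ|a|` for free (`|A°₀| ≤ m`); the first is the member DIFFERENCE at scale `0`, which by `klmf_carrier_sub_eq`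
(p593510, at `Λ₁ = Λ = Λ₀`) is `𝒱₄((e^{Δ_{softCovOf s_{j′,j}}} − 1)·e^{Δ_{softCovOf s_{0,j′}}}𝒱₀)` — ONE binomial–Gram smearing estimate with a MASS-sensitive Gram constant of the
`D = s_{j′,j}`-line (scale-0 lane: kernel norms of `e^{Δ_S}𝒱₀` as in `…EngineScaleZeroTransfer`, Gram from the symbol mass as in
`isGramBoundedR_gridSub_pullback_normalCovariance_of_mass_le`).  This file is the composition: the base from that ONE estimate `η`.
* `kltc_relResidue_le_of_sub` — `‖Ẽ(x,y)‖ ≤ η(x,y) + m²·Σ_c‖a_c‖` from `‖(A₁ − A₂)(x,y)‖ ≤ η(x,y)`, `|A₁|, |A₂| ≤ m`;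
* **`pairTransferRelResIdx_zero_of_smearingBound`** — the private family at `0` from, per pair `(j, j′)` and class `Qm`: `|A°₀[s_{0,j}]|, |A°₀[s_{0,j′}]| ≤ mA`, the smearing estimate
  `‖(A°₀[s_{0,j}] − A°₀[s_{0,j′}])(k,k′)‖ ≤ η k k′` on the ball, and `η + mA²·Σ|t₀[s_j] − t₀[s_j′]| ≤ RB 0 j j′ Qm` on the ball.
Plumbing; nothing about the model's sizes is asserted; nothing asserts superconductivity.  0 kit.
-/

noncomputable section

namespace Summit.HubbardSuperconductivity.HubbardSuperconductivity.Theorems.KLRegimeSplit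

set_option linter.dupNamespace false -- summit = problem name (single-conjunct summit), D-0017

open Finset Matrix Set Literature.MathematicalPhysics.QuantumLattice Literature.Probability.LatticeModels
open Summit.HubbardSuperconductivity.HubbardSuperconductivity.Theorems.KLProgrammeCooperResummation
open Summit.HubbardSuperconductivity.HubbardSuperconductivity.Theorems.KLProgrammeLegKernels
open Summit.HubbardSuperconductivity.HubbardSuperconductivity.Theorems.DispersionFlow
open Summit.HubbardSuperconductivity.HubbardSuperconductivity.Theorems.EngineV8

section Generic

variable {ι : Type*} [Fintype ι] [DecidableEq ι]

/-- **The relative residue from the plain difference**: `‖(A₁ + A₁·diag a·A₂ − A₂)(x,y)‖ ≤ η(x,y) + m²·Σ_c‖a_c‖` when `‖(A₁ − A₂)(x,y)‖ ≤ η(x,y)` and `|A₁|, |A₂| ≤ m`. -/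
theorem kltc_relResidue_le_of_sub (A₁ A₂ : Matrix ι ι ℂ) (a : ι → ℂ) (η : ι → ι → ℝ) {m : ℝ} (hm : 0 ≤ m)
    (hA₁ : ∀ x y, ‖A₁ x y‖ ≤ m) (hA₂ : ∀ x y, ‖A₂ x y‖ ≤ m) (hη : ∀ x y, ‖(A₁ - A₂) x y‖ ≤ η x y) (x y : ι) :
    ‖(A₁ + A₁ * diagonal a * A₂ - A₂) x y‖ ≤ η x y + m * m * ∑ c, ‖a c‖ := by
  have e : A₁ + A₁ * diagonal a * A₂ - A₂ = (A₁ - A₂) + A₁ * diagonal a * A₂ := by abel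
  rw [e, Matrix.add_apply]
  refine (norm_add_le _ _).trans (add_le_add (hη x y) ?_)
  rw [klli_mul_diag_mul_apply, Finset.mul_sum]
  refine (norm_sum_le _ _).trans (sum_le_sum fun c _ => ?_)
  rw [norm_mul, norm_mul]
  calc ‖A₁ x c‖ * ‖a c‖ * ‖A₂ c y‖ ≤ m * ‖a c‖ * m :=
        mul_le_mul (mul_le_mul_of_nonneg_right (hA₁ x c) (norm_nonneg _)) (hA₂ c y) (norm_nonneg _) (mul_nonneg hm (norm_nonneg _))
    _ = m * m * ‖a c‖ := by ring

end Generic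

section Base

variable (L M : ℕ) [NeZero L] [NeZero M]

/-- **The `n = 0` base of the private relative-residue family from ONE smearing estimate per pair** (see the module docstring). -/
theorem pairTransferRelResIdx_zero_of_smearingBound {β U μ : ℝ} {mA : ℝ} (hm : 0 ≤ mA)
    {RB : ℕ → ℕ → ℕ → TorusSite 2 L → TorusSite 2 L → TorusSite 2 L → ℝ}
    (hdata : ∀ j j' : ℕ, 0 ≤ j' → j' ≤ j → j ≤ nScales β + 1 → ∀ Qm : TorusSite 2 L, IsPairClassAt L Qm 0 →
      ∃ η : TorusSite 2 L → TorusSite 2 L → ℝ,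
        (∀ x y, ‖klMemberArrayF L M β U μ 0 (softSymbolCompl L M β μ (klFlowFrameU L M β U μ 0) 0 j) Qm x y‖ ≤ mA) ∧
        (∀ x y, ‖klMemberArrayF L M β U μ 0 (softSymbolCompl L M β μ (klFlowFrameU L M β U μ 0) 0 j') Qm x y‖ ≤ mA) ∧
        (∀ k ∈ klBall L μ 0, ∀ k' ∈ klBall L μ 0,
          ‖(klMemberArrayF L M β U μ 0 (softSymbolCompl L M β μ (klFlowFrameU L M β U μ 0) 0 j) Qm -
              klMemberArrayF L M β U μ 0 (softSymbolCompl L M β μ (klFlowFrameU L M β U μ 0) 0 j') Qm) k k'‖ ≤ η k k') ∧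
        (∀ k ∈ klBall L μ 0, ∀ k' ∈ klBall L μ 0, η k k' + mA * mA *
          ∑ c, ‖(-(((klTransferWeight L M β μ (klFlowFrameU L M β U μ 0) 0 (softSymbolCompl L M β μ (klFlowFrameU L M β U μ 0) 0 j) Qm c -
            klTransferWeight L M β μ (klFlowFrameU L M β U μ 0) 0 (softSymbolCompl L M β μ (klFlowFrameU L M β U μ 0) 0 j') Qm c : ℝ)) : ℂ))‖ ≤
          RB 0 j j' Qm k k')) :
    ∀ j j' : ℕ, 0 ≤ j' → j' ≤ j → j ≤ nScales β + 1 → ∀ Qm : TorusSite 2 L, IsPairClassAt L Qm 0 →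
      ∀ k ∈ klBall L μ 0, ∀ k' ∈ klBall L μ 0,
      ‖(klMemberArrayF L M β U μ 0 (softSymbolCompl L M β μ (klFlowFrameU L M β U μ 0) 0 j) Qm +
          klMemberArrayF L M β U μ 0 (softSymbolCompl L M β μ (klFlowFrameU L M β U μ 0) 0 j) Qm *
          diagonal (fun c => -(((klTransferWeight L M β μ (klFlowFrameU L M β U μ 0) 0 (softSymbolCompl L M β μ (klFlowFrameU L M β U μ 0) 0 j) Qm c -
            klTransferWeight L M β μ (klFlowFrameU L M β U μ 0) 0 (softSymbolCompl L M β μ (klFlowFrameU L M β U μ 0) 0 j') Qm c : ℝ)) : ℂ)) *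
          klMemberArrayF L M β U μ 0 (softSymbolCompl L M β μ (klFlowFrameU L M β U μ 0) 0 j') Qm -
          klMemberArrayF L M β U μ 0 (softSymbolCompl L M β μ (klFlowFrameU L M β U μ 0) 0 j') Qm) k k'‖ ≤ RB 0 j j' Qm k k' := by
  intro j j' h1 h2 h3 Qm hQm k hk k' hk'
  obtain ⟨η, hA₁, hA₂, hη, hbud⟩ := hdata j j' h1 h2 h3 Qm hQm
  -- the difference bound, globally (zero off the ball)
  have hη' : ∀ x y, ‖(klMemberArrayF L M β U μ 0 (softSymbolCompl L M β μ (klFlowFrameU L M β U μ 0) 0 j) Qm -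
      klMemberArrayF L M β U μ 0 (softSymbolCompl L M β μ (klFlowFrameU L M β U μ 0) 0 j') Qm) x y‖ ≤
      (if x ∈ klBall L μ 0 ∧ y ∈ klBall L μ 0 then η x y else 0) := by
    intro x y
    by_cases hxy : x ∈ klBall L μ 0 ∧ y ∈ klBall L μ 0
    · rw [if_pos hxy]; exact hη x hxy.1 y hxy.2
    · rw [if_neg hxy, Matrix.sub_apply, klMemberArrayF_eq_zero_off β U μ 0 _ Qm hxy, klMemberArrayF_eq_zero_off β U μ 0 _ Qm hxy, sub_zero,
        norm_zero]
  have h := kltc_relResidue_le_of_sub _ _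
    (fun c => -(((klTransferWeight L M β μ (klFlowFrameU L M β U μ 0) 0 (softSymbolCompl L M β μ (klFlowFrameU L M β U μ 0) 0 j) Qm c -
      klTransferWeight L M β μ (klFlowFrameU L M β U μ 0) 0 (softSymbolCompl L M β μ (klFlowFrameU L M β U μ 0) 0 j') Qm c : ℝ)) : ℂ))
    _ hm hA₁ hA₂ hη' k k'
  rw [if_pos ⟨hk, hk'⟩] at h
  exact h.trans (hbud k hk k' hk')

end Base

end Summit.HubbardSuperconductivity.HubbardSuperconductivity.Theorems.KLRegimeSplit

end
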